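import Summits.Ventures.PercRepro.PlaneCore

/-!
# PercRepro — Lemma ρ without the catalogue: `35·cyc₃(G) ≤ 64·τ₃(G)` on every rank-3 set with ≤ 7 points and
lines ≤ 3 points (p2, gen 11)

Night-1's counting route to C-025 at `q = 3` (`proofs/NIGHT-1-C025-induction.md` §12) bounds the cyclic rank-`3`
sets of the core by `Λ₃ ≤ ρ·#{rank-3 triples}` with `ρ = 64/35`, the maximum of `cyc₃(P)/τ₃(P)` over the simple
planes `P` with `≤ 7` points and lines `≤ 3` points — read off the catalogue of planes on `≤ 7` points
(`plane_ratio.py`). `proofs/P2-RHO.md` replaces the catalogue by a count: on such a set `G` with `g` points and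
`ℓ` rank-`2` triples, (a) the rank-`≤ 2` subsets with `3` points are exactly the `ℓ` triples, so `τ₃ = C(g,3) − ℓ`,
and every subset with `≥ 4` points has rank `3`; (b) a subset with `≥ 4` points is NOT cyclic iff it is
«rank-`2` triple + one point» — these are `ℓ·(g − 3)` distinct sets; (c) hence
`cyc₃(G) ≤ 2^g − Σ_{j≤3} C(g,j) − ℓ(g − 3)`, and for `g ≤ 7` this is `≤ (64/35)·(C(g,3) − ℓ)` (equality exactly
at `g = 7`, `ℓ = 0`, i.e. `U_{3,7}`). Everything below is that count, for an arbitrary finset `G` of rank `3`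
inside the ground set of a simple finite matroid, under (C1) stated for the subsets of `G`.

* `CyclicF` — a finset is cyclic if removing any element keeps the rank (no coloop of the restriction);
* `cyc3`, `tau3`, `ell3` — the three counts inside `G`;
* `eRk_eq_three_of_four_le` — (C1) + simplicity: every subset of `G` with `≥ 4` points has rank `3`;
* `eq_of_rank_le_two_triples` — a `4`-subset of `G` contains at most one rank-`≤ 2` triple (submodularity);
* `not_cyclicF_insert` — «triple + point» is not cyclic; `card_nonCyclicImage` — there are `ℓ·(g − 3)` such sets;
* `tau3_add_ell3`, `cyc3_add_nonCyc`, `card_four_le_add_sum_choose` — the three counting identities;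
* **`thirtyfive_mul_cyc3_le`** — `35·cyc₃(G) ≤ 64·τ₃(G)` for `G.card ≤ 7`.
Imports `PlaneCore` (for `ThmH.Simple`, `ThmH.gr`, `ThmH.eRk_eq_nat`) only. Axioms: standard.
-/

namespace PercRepro
namespace RhoLemma

open Finset

variable {α : Type*} [DecidableEq α] {M : Matroid α} [M.Finite]

/-- A finset `S` is CYCLIC for `M` (every element lies in a circuit inside `S`, i.e. `M|S` has no coloop): removing
any element keeps the rank. -/
def CyclicF (M : Matroid α) (S : Finset α) : Prop :=
  ∀ x ∈ S, M.eRk ((S.erase x : Finset α) : Set α) = M.eRk (S : Set α)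

open scoped Classical in
/-- `cyc₃(G)`: the number of cyclic subsets of `G` with at least `4` elements (under (C1) exactly the cyclic
rank-`3` subsets of `G`). -/
noncomputable def cyc3 (M : Matroid α) (G : Finset α) : ℕ :=
  (G.powerset.filter (fun (S : Finset α) => 4 ≤ S.card ∧ CyclicF M S)).card

open scoped Classical in
/-- `τ₃(G)`: the number of rank-`3` triples of `G`. -/
noncomputable def tau3 (M : Matroid α) (G : Finset α) : ℕ :=
  (G.powerset.filter (fun (T : Finset α) => T.card = 3 ∧ M.eRk (T : Set α) = 3)).card

open scoped Classical in
/-- `ℓ(G)`: the number of rank-`≤ 2` triples of `G` (the `3`-point lines inside `G`). -/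
noncomputable def ell3 (M : Matroid α) (G : Finset α) : ℕ :=
  (G.powerset.filter (fun (T : Finset α) => T.card = 3 ∧ M.eRk (T : Set α) ≤ 2)).card

open scoped Classical in
/-- The «triple + point» sets: `T ∪ {x}` for a rank-`≤ 2` triple `T ⊆ G` and `x ∈ G ∖ T`. -/
noncomputable def nonCycImage (M : Matroid α) (G : Finset α) : Finset (Finset α) :=
  (G.powerset.filter (fun (T : Finset α) => T.card = 3 ∧ M.eRk (T : Set α) ≤ 2)).biUnion
    (fun T => (G \ T).image (fun x => insert x T))

/-! ### (a) every subset of `G` with `≥ 4` points has rank `3` -/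

omit [DecidableEq α] in
/-- Two distinct points of the ground set give a set of rank `≥ 2` (simplicity). -/
theorem two_le_eRk_of_ne (hs : ThmH.Simple M) {S : Finset α} (hS : S ⊆ ThmH.gr M) {e f : α}
    (he : e ∈ S) (hf : f ∈ S) (hef : e ≠ f) : 2 ≤ M.eRk (S : Set α) := by
  have hE : ((ThmH.gr M : Finset α) : Set α) = M.E := ThmH.coe_gr M
  have heE : e ∈ M.E := by rw [← hE]; exact_mod_cast hS he
  have hfE : f ∈ M.E := by rw [← hE]; exact_mod_cast hS hf
  have h2 : M.eRk {e, f} = 2 := hs e heE f hfE hef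
  have hsub : ({e, f} : Set α) ⊆ (S : Set α) := by
    intro x hx
    simp only [Set.mem_insert_iff, Set.mem_singleton_iff] at hx
    rcases hx with rfl | rfl
    · exact_mod_cast he
    · exact_mod_cast hf
  rw [← h2]
  exact M.eRk_mono hsub

omit [DecidableEq α] in
/-- **(a)** Under (C1) and simplicity, a subset of a rank-`3` set `G` with `≥ 4` points has rank exactly `3`. -/
theorem eRk_eq_three_of_four_le (hs : ThmH.Simple M) {G : Finset α} (hG : G ⊆ ThmH.gr M)
    (hr : M.eRk (G : Set α) = 3) (hC1 : ∀ T ⊆ G, M.eRk (T : Set α) = 2 → T.card ≤ 3)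
    {S : Finset α} (hS : S ⊆ G) (h4 : 4 ≤ S.card) : M.eRk (S : Set α) = 3 := by
  obtain ⟨k, hk, -⟩ := ThmH.eRk_eq_nat M S
  have hle : M.eRk (S : Set α) ≤ 3 := by rw [← hr]; exact M.eRk_mono (Finset.coe_subset.2 hS)
  rw [hk] at hle ⊢
  have hk3 : k ≤ 3 := by exact_mod_cast hle
  -- two distinct points of `S`
  have hlt : 1 < S.card := by omega
  obtain ⟨e, he, f, hf, hef⟩ : ∃ e ∈ S, ∃ f ∈ S, e ≠ f := Finset.one_lt_card.1 hlt
  have h2 := two_le_eRk_of_ne hs (hS.trans hG) he hf hef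
  rw [hk] at h2
  have hk2 : 2 ≤ k := by exact_mod_cast h2
  rcases Nat.lt_or_ge k 3 with hlt | hge
  · have hk2' : k = 2 := by omega
    have h3 : S.card ≤ 3 := hC1 S hS (by rw [hk, hk2']; rfl)
    exact absurd (le_trans h4 h3) (by norm_num)
  · have hk3' : k = 3 := by omega
    rw [hk3']
    rfl

/-! ### (b) a `4`-subset contains at most one rank-`≤ 2` triple -/

/-- **(b)** In a `4`-subset `S` of `G`, two rank-`≤ 2` triples coincide (else `S = T ∪ T'` would have rank `≤ 2` by
submodularity, against (a)). -/
theorem eq_of_rank_le_two_triples (hs : ThmH.Simple M) {G : Finset α} (hG : G ⊆ ThmH.gr M)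
    (hr : M.eRk (G : Set α) = 3) (hC1 : ∀ T ⊆ G, M.eRk (T : Set α) = 2 → T.card ≤ 3)
    {S T T' : Finset α} (hS : S ⊆ G) (h4 : S.card = 4) (hT : T ⊆ S) (hT' : T' ⊆ S)
    (hTc : T.card = 3) (hT'c : T'.card = 3) (hTr : M.eRk (T : Set α) ≤ 2) (hT'r : M.eRk (T' : Set α) ≤ 2) :
    T = T' := by
  by_contra hne
  -- `|T ∩ T'| = 2` and `T ∪ T' = S`
  have hinter : (T ∩ T').card < 3 := by
    by_contra hge
    push Not at hge
    have : T ∩ T' = T := Finset.eq_of_subset_of_card_le Finset.inter_subset_left (by omega)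
    have h1 : T ⊆ T' := by rw [← this]; exact Finset.inter_subset_right
    exact hne (Finset.eq_of_subset_of_card_le h1 (by omega))
  have hunion : (T ∪ T').card + (T ∩ T').card = T.card + T'.card := Finset.card_union_add_card_inter T T'
  have hunion_le : (T ∪ T').card ≤ 4 := by rw [← h4]; exact Finset.card_le_card (Finset.union_subset hT hT')
  have hinter2 : (T ∩ T').card = 2 := by omega
  have hTT'S : T ∪ T' = S := Finset.eq_of_subset_of_card_le (Finset.union_subset hT hT') (by omega)
  -- the intersection has rank `2` (simplicity)
  obtain ⟨a, b, hab, habeq⟩ := Finset.card_eq_two.1 hinter2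
  have hinterE : T ∩ T' ⊆ ThmH.gr M := (Finset.inter_subset_left.trans hT).trans (hS.trans hG)
  have hrinter : 2 ≤ M.eRk ((T ∩ T' : Finset α) : Set α) :=
    two_le_eRk_of_ne hs hinterE (by rw [habeq]; simp) (by rw [habeq]; simp) hab
  -- submodularity
  have hsub := M.eRk_inter_add_eRk_union_le (T : Set α) (T' : Set α)
  rw [← Finset.coe_inter, ← Finset.coe_union, hTT'S] at hsub
  have hS3 : M.eRk (S : Set α) = 3 := eRk_eq_three_of_four_le hs hG hr hC1 hS (by omega)
  rw [hS3] at hsub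
  -- `2 + 3 ≤ eRk(T ∩ T') + 3 ≤ eRk T + eRk T' ≤ 2 + 2`: contradiction in `ℕ∞`
  have h0 : (2 : ℕ∞) + 3 ≤ M.eRk ((T ∩ T' : Finset α) : Set α) + 3 := by gcongr
  have h1 : (2 : ℕ∞) + 3 ≤ M.eRk (T : Set α) + M.eRk (T' : Set α) := le_trans h0 hsub
  have h2 : M.eRk (T : Set α) + M.eRk (T' : Set α) ≤ 2 + 2 := add_le_add hTr hT'r
  have h3 : (2 : ℕ∞) + 3 ≤ 2 + 2 := h1.trans h2
  norm_num at h3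

/-! ### the «triple + point» sets are not cyclic, and there are `ℓ·(g − 3)` of them -/

/-- «Triple + point» is not cyclic: the point is a coloop (removing it drops the rank from `3` to `≤ 2`). -/
theorem not_cyclicF_insert (hs : ThmH.Simple M) {G : Finset α} (hG : G ⊆ ThmH.gr M)
    (hr : M.eRk (G : Set α) = 3) (hC1 : ∀ T ⊆ G, M.eRk (T : Set α) = 2 → T.card ≤ 3)
    {T : Finset α} (hT : T ⊆ G) (hTc : T.card = 3) (hTr : M.eRk (T : Set α) ≤ 2) {x : α} (hx : x ∈ G)
    (hxT : x ∉ T) : ¬ CyclicF M (insert x T) := by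
  intro hcyc
  have hmem : x ∈ insert x T := Finset.mem_insert_self x T
  have h := hcyc x hmem
  rw [Finset.erase_insert hxT] at h
  have hS : insert x T ⊆ G := Finset.insert_subset hx hT
  have hcard : (insert x T).card = 4 := by rw [Finset.card_insert_of_notMem hxT, hTc]
  have h3 : M.eRk ((insert x T : Finset α) : Set α) = 3 :=
    eRk_eq_three_of_four_le hs hG hr hC1 hS (by omega)
  rw [h3] at h
  have : (3 : ℕ∞) ≤ 2 := h ▸ hTr
  norm_num at this

open scoped Classical in
/-- The «triple + point» sets are subsets of `G` with `4` points that are not cyclic. -/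
theorem nonCycImage_subset (hs : ThmH.Simple M) {G : Finset α} (hG : G ⊆ ThmH.gr M)
    (hr : M.eRk (G : Set α) = 3) (hC1 : ∀ T ⊆ G, M.eRk (T : Set α) = 2 → T.card ≤ 3) :
    nonCycImage M G ⊆ G.powerset.filter (fun (S : Finset α) => 4 ≤ S.card ∧ ¬ CyclicF M S) := by
  intro S hS
  unfold nonCycImage at hS
  rw [Finset.mem_biUnion] at hS
  obtain ⟨T, hT, hST⟩ := hS
  rw [Finset.mem_filter, Finset.mem_powerset] at hT
  obtain ⟨hTG, hTc, hTr⟩ := hT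
  rw [Finset.mem_image] at hST
  obtain ⟨x, hx, rfl⟩ := hST
  rw [Finset.mem_sdiff] at hx
  rw [Finset.mem_filter, Finset.mem_powerset]
  refine ⟨Finset.insert_subset hx.1 hTG, ?_, not_cyclicF_insert hs hG hr hC1 hTG hTc hTr hx.1 hx.2⟩
  rw [Finset.card_insert_of_notMem hx.2, hTc]

open scoped Classical in
/-- **There are exactly `ℓ·(g − 3)` «triple + point» sets**: the pairs `(T, x)` give distinct sets. -/
theorem card_nonCycImage (hs : ThmH.Simple M) {G : Finset α} (hG : G ⊆ ThmH.gr M)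
    (hr : M.eRk (G : Set α) = 3) (hC1 : ∀ T ⊆ G, M.eRk (T : Set α) = 2 → T.card ≤ 3) :
    (nonCycImage M G).card = ell3 M G * (G.card - 3) := by
  unfold nonCycImage ell3
  set ES := G.powerset.filter (fun (T : Finset α) => T.card = 3 ∧ M.eRk (T : Set α) ≤ 2) with hES
  have hmemES : ∀ T ∈ ES, T ⊆ G ∧ T.card = 3 ∧ M.eRk (T : Set α) ≤ 2 := by
    intro T hT
    rw [hES, Finset.mem_filter, Finset.mem_powerset] at hT
    exact ⟨hT.1, hT.2.1, hT.2.2⟩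
  -- pairwise disjoint images
  have hdisj : (ES : Set (Finset α)).PairwiseDisjoint (fun T => (G \ T).image (fun x => insert x T)) := by
    intro T hT T' hT' hne
    rw [Function.onFun, Finset.disjoint_left]
    intro S hS hS'
    rw [Finset.mem_image] at hS hS'
    obtain ⟨x, hx, rfl⟩ := hS
    obtain ⟨x', hx', hxx'⟩ := hS'
    rw [Finset.mem_sdiff] at hx hx'
    obtain ⟨hTG, hTc, hTr⟩ := hmemES T hT
    obtain ⟨hT'G, hT'c, hT'r⟩ := hmemES T' hT'
    have hSG : insert x T ⊆ G := Finset.insert_subset hx.1 hTG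
    have hS4 : (insert x T).card = 4 := by rw [Finset.card_insert_of_notMem hx.2, hTc]
    have hTsub : T ⊆ insert x T := Finset.subset_insert x T
    have hT'sub : T' ⊆ insert x T := by rw [← hxx']; exact Finset.subset_insert x' T'
    exact hne (eq_of_rank_le_two_triples hs hG hr hC1 hSG hS4 hTsub hT'sub hTc hT'c hTr hT'r)
  rw [Finset.card_biUnion hdisj]
  -- each image has `g − 3` elements
  have himg : ∀ T ∈ ES, ((G \ T).image (fun x => insert x T)).card = G.card - 3 := by
    intro T hT
    obtain ⟨hTG, hTc, -⟩ := hmemES T hT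
    rw [Finset.card_image_of_injOn, Finset.card_sdiff_of_subset hTG, hTc]
    intro x hx x' hx' hxx'
    have hxx'' : insert x T = insert x' T := hxx'
    simp only [Finset.coe_sdiff, Set.mem_sdiff, Finset.mem_coe] at hx hx'
    have : x ∈ insert x' T := by rw [← hxx'']; exact Finset.mem_insert_self x T
    rw [Finset.mem_insert] at this
    rcases this with h | h
    · exact h
    · exact absurd h hx.2
  rw [Finset.sum_congr rfl himg, Finset.sum_const, smul_eq_mul]

/-! ### the three counting identities -/

omit [DecidableEq α] in
open scoped Classical in
/-- `τ₃(G) + ℓ(G) = C(g, 3)`: a triple of `G` has rank `3` or rank `≤ 2`. -/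
theorem tau3_add_ell3 (M : Matroid α) [M.Finite] (G : Finset α) :
    tau3 M G + ell3 M G = Nat.choose G.card 3 := by
  unfold tau3 ell3
  have h1 : G.powerset.filter (fun (T : Finset α) => T.card = 3 ∧ M.eRk (T : Set α) = 3)
      = (G.powerset.filter (fun (T : Finset α) => T.card = 3)).filter (fun (T : Finset α) => M.eRk (T : Set α) = 3) := by
    rw [Finset.filter_filter]
  have h2 : G.powerset.filter (fun (T : Finset α) => T.card = 3 ∧ M.eRk (T : Set α) ≤ 2)
      = (G.powerset.filter (fun (T : Finset α) => T.card = 3)).filter (fun (T : Finset α) => ¬ M.eRk (T : Set α) = 3) := by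
    rw [Finset.filter_filter]
    apply Finset.filter_congr
    intro T hT
    rw [Finset.mem_powerset] at hT
    constructor
    · rintro ⟨hc, hle⟩
      refine ⟨hc, ?_⟩
      intro h3
      rw [h3] at hle
      norm_num at hle
    · rintro ⟨hc, hne⟩
      refine ⟨hc, ?_⟩
      obtain ⟨k, hk, hkle⟩ := ThmH.eRk_eq_nat M T
      rw [hk] at hne ⊢
      rw [hc] at hkle
      have : k ≠ 3 := by intro h; apply hne; rw [h]; rfl
      have hk2 : k ≤ 2 := by omega
      exact_mod_cast hk2
  rw [h1, h2, Finset.card_filter_add_card_filter_not, ← Finset.powersetCard_eq_filter,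
    Finset.card_powersetCard]

open scoped Classical in
/-- `cyc₃(G) + #{non-cyclic subsets with ≥ 4 points} = #{subsets with ≥ 4 points}`. -/
theorem cyc3_add_nonCyc (M : Matroid α) [M.Finite] (G : Finset α) :
    cyc3 M G + (G.powerset.filter (fun (S : Finset α) => 4 ≤ S.card ∧ ¬ CyclicF M S)).card
      = (G.powerset.filter (fun (S : Finset α) => 4 ≤ S.card)).card := by
  unfold cyc3
  have h1 : G.powerset.filter (fun (S : Finset α) => 4 ≤ S.card ∧ CyclicF M S)
      = (G.powerset.filter (fun (S : Finset α) => 4 ≤ S.card)).filter (fun (S : Finset α) => CyclicF M S) := by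
    rw [Finset.filter_filter]
  have h2 : G.powerset.filter (fun (S : Finset α) => 4 ≤ S.card ∧ ¬ CyclicF M S)
      = (G.powerset.filter (fun (S : Finset α) => 4 ≤ S.card)).filter (fun (S : Finset α) => ¬ CyclicF M S) := by
    rw [Finset.filter_filter]
  rw [h1, h2, Finset.card_filter_add_card_filter_not]

open scoped Classical in
/-- `#{subsets with ≥ 4 points} + Σ_{j<4} C(g,j) = 2^g`. -/
theorem card_four_le_add_sum_choose (G : Finset α) :
    (G.powerset.filter (fun (S : Finset α) => 4 ≤ S.card)).card + ∑ j ∈ range 4, Nat.choose G.card j = 2 ^ G.card := by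
  have hsmall : (G.powerset.filter (fun (S : Finset α) => ¬ 4 ≤ S.card)) = (range 4).biUnion (fun j => powersetCard j G) := by
    ext S
    simp only [Finset.mem_filter, Finset.mem_powerset, Finset.mem_biUnion, Finset.mem_range,
      Finset.mem_powersetCard, not_le]
    constructor
    · rintro ⟨hS, hc⟩
      exact ⟨S.card, hc, hS, rfl⟩
    · rintro ⟨j, hj, hS, rfl⟩
      exact ⟨hS, hj⟩
  have hcard : ((range 4).biUnion (fun j => powersetCard j G)).card = ∑ j ∈ range 4, Nat.choose G.card j := by
    rw [Finset.card_biUnion]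
    · apply Finset.sum_congr rfl
      intro j _
      exact Finset.card_powersetCard j G
    · intro i _ j _ hij
      exact Finset.pairwise_disjoint_powersetCard G hij
  rw [← hcard, ← hsmall, Finset.card_filter_add_card_filter_not, Finset.card_powerset]

/-! ### Lemma ρ -/

/-- **Lemma ρ (catalogue-free)**: on a rank-`3` set `G` with `≤ 7` points, inside a simple finite matroid, whose
rank-`2` subsets have `≤ 3` points, `35·cyc₃(G) ≤ 64·τ₃(G)` — the bound `Λ₃ ≤ (64/35)·#{rank-3 triples}` of
NIGHT-1 §12 with `ρ = 64/35` the ratio of `U_{3,7}`, by counting alone. -/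
theorem thirtyfive_mul_cyc3_le (hs : ThmH.Simple M) {G : Finset α} (hG : G ⊆ ThmH.gr M)
    (hr : M.eRk (G : Set α) = 3) (hC1 : ∀ T ⊆ G, M.eRk (T : Set α) = 2 → T.card ≤ 3)
    (hg : G.card ≤ 7) : 35 * cyc3 M G ≤ 64 * tau3 M G := by
  classical
  have h1 := cyc3_add_nonCyc M G
  have h2 := card_four_le_add_sum_choose G
  have h3 := tau3_add_ell3 M G
  have h4 : ell3 M G * (G.card - 3) ≤ (G.powerset.filter (fun (S : Finset α) => 4 ≤ S.card ∧ ¬ CyclicF M S)).card := by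
    rw [← card_nonCycImage hs hG hr hC1]
    exact Finset.card_le_card (nonCycImage_subset hs hG hr hC1)
  set g := G.card with hg_def
  set cyc := cyc3 M G
  set nc := (G.powerset.filter (fun (S : Finset α) => 4 ≤ S.card ∧ ¬ CyclicF M S)).card
  set N := (G.powerset.filter (fun (S : Finset α) => 4 ≤ S.card)).card
  set t := tau3 M G
  set l := ell3 M G
  clear_value g cyc nc N t l
  interval_cases g <;> simp [Finset.sum_range_succ, Nat.choose] at h2 h3 <;> omega

end RhoLemma
end PercRepro
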